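import Mathlib.RingTheory.GradedAlgebra.Basic
import Mathlib.Algebra.Ring.Commute
import Literature.Algebra.Lie.LefschetzModule
import Literature.Algebra.Lie.LefschetzModuleInvariantFormIrreducible
import HarnessLib

/-!
# Lefschetz algebras and their invariant form (Looijenga–Lunts 1997, §1 (1.4))

Topic `Literature/Algebra/Lie` (namespace `Literature.Algebra.Lie`).  Lane `lit-hodgefound` (Track 2 foundations
library), skeleton seat `lit-hodgefound-skel-1` (generation 43), row **A1-119** (and its rider **A1-122**, §5) of
`run/shared/lean/pub/lit-hodgefound/SKELETON.md`: Looijenga–Lunts' (1.4) — the notion of a LEFSCHETZ ALGEBRA (a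
graded-commutative algebra `A = ⊕_{i=0}^{2n} A_i`, `A_0 = K`, such that the shifted module `A[n]` is a Lefschetz
module of depth `n` over `A_2` acting by multiplication, in the sense of A1-88 `IsLefschetzModule`) and its invariant
`(-1)^n`-symmetric bilinear form `φ(a, b) = (-1)^q ∫(ab)`.  DEFINITIONS WITH BODIES (`gradedScalar`, `shiftedDegree`,
`mulLeftDegTwo`, `IsGradedCommutative`, `IsLefschetzAlgebra`, `lefschetzSign`, `lefschetzForm`) and PROVED
theorems; no named fact, no `sorry` (D-0026 net debt `0`).  Mathlib's graded-algebra vocabulary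
(`GradedAlgebra 𝒜`, `DirectSum.decompose`) and the tree's (`degreeSpace`, `IsZGrading`, `adDegree`,
`IsLefschetzModule`, `depth`).  `LieRing.ofAssociativeRing` on `𝔤𝔩(A) = Module.End K A` is enabled FILE-LOCALLY as
in the rest of the series.

STANDING ASSUMPTIONS (the paper's, p0003: "`K` is a field of characteristic zero", modules finite-dimensional): the
substantive statements below carry `[CharZero K]` and `[FiniteDimensional K A]`; outside characteristic `0` the
eigenspace rendering `degreeSpace (shiftedDegree K 𝒜 n) (i - n)` of `A[n]_{i-n} = A_i` is NOT the printed graded notion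
(`degreeSpace_shiftedDegree_eq` needs `CharZero K`).  DEPTH ZERO: the rendering forces `n ≥ 1`
(`IsLefschetzAlgebra.depth_pos`): for `n = 0`, `A = A_0 = K` and `h = shiftedDegree K 𝒜 0 = 0`, which A1-88's
`IsLefschetzModule` excludes (`h ≠ 0`, Mathlib's `IsSl2Triple` convention) — the paper is silent on Lefschetz algebras
of depth `0`.  A MODEL (non-vacuity witness): `H^•(ℙ¹) = K[ε]/(ε²)`, `deg ε = 2`, is a Lefschetz algebra of depth `1`
— `LefschetzAlgebraDualNumber.lean` (row A1-121).

## Source, VERBATIM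

E. Looijenga, V. A. Lunts, *A Lie algebra attached to a projective variety*, Invent. Math. **129** (1997) 361–412,
§1 (1.4) (held TeX text `paper:arxiv-alg-geom_9604014`, p0005 L17–L29; the extracted PDF text `paper:arxiv-alg-geom-9604014`
p0007 drops the clause defining `∫`):

> "(1.4) Many Lefschetz modules have the additional structure of an algebra. Let `A = ⊕_{i=0}^{2n} A_i` be a
> graded-commutative algebra with `A_0 = K`. We say that `A` is a Lefschetz algebra of depth `n` if `A[n]` is a
> Lefschetz module of depth `n` over `A_2`. Such a Lefschetz module can be endowed with an invariant
> `(-)^n`-symmetric bilinear form: let `∫ : A → K` be a linear form that is an isomorphism in degree `2n` and zero in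
> all other degrees and define `φ(a, b) := (-1)^q ∫(ab)` if `a` is homogeneous of degree `n + 2q` or `n + 2q + 1`. If
> this form is nondegenerate (which is for instance the case when `A[n]` is irreducible as a Lefschetz module), then
> the form `(a, b) ↦ ∫(ab)` is also nondegenerate and so `A` becomes a Frobenius algebra (in the graded sense)."

and §1 (1.1) p0004 L28–L29 (the `𝔞` of a Lefschetz module is "a graded abelian Lie algebra which is homogeneous of
degree two"), (1.3) p0007 ("an invariant bilinear form on `M` … `φ` is zero on `M_k × M_l` unless `k + l = 0` and
`𝔞` preserves the form `φ` infinitesimally: `φ(e_a m, m') + φ(m, e_a m') = 0`").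

## Rendering (dictionary)

* "`A = ⊕_{i=0}^{2n} A_i` … graded … algebra": a `K`-algebra `A` with a Mathlib grading `𝒜 : ℕ → Submodule K A`,
  `[GradedAlgebra 𝒜]` (so `1 ∈ A_0`, `A_i A_j ⊆ A_{i+j}`, `A = ⊕ A_i`), together with `A_i = 0` for `i > 2n`
  (`IsLefschetzAlgebra.eq_bot_of_lt`).
* "graded-commutative": `IsGradedCommutative K 𝒜` — `y x = (-1)^{ij} x y` for `x ∈ A_i`, `y ∈ A_j`.
* "`A_0 = K`": every element of `A_0` is a scalar, `IsLefschetzAlgebra.exists_algebraMap_eq`.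
* "`A[n]`", the shifted grading `A[n]_k = A_{k+n}`: the degree operator `shiftedDegree K 𝒜 n ∈ 𝔤𝔩(A)` acting by
  `i - n` on `A_i` (`shiftedDegree_apply_of_mem`; `degreeSpace (shiftedDegree K 𝒜 n) (i - n) = A_i`,
  `degreeSpace_shiftedDegree_eq`), in the vocabulary `(M, h)` of A1-88.
* "over `A_2`": the subspace `mulLeftDegTwo K 𝒜 = {L_a | a ∈ A_2} ⊆ 𝔤𝔩(A)` of left multiplications (the image of
  `e : A_2 → 𝔤𝔩(A)`, `e_a = L_a` — the `𝔞` of A1-88, which identifies `𝔞` with its image).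
* "`A[n]` is a Lefschetz module of depth `n` over `A_2`": `IsLefschetzModule K (shiftedDegree K 𝒜 n)
  (mulLeftDegTwo K 𝒜)` (A1-88) and `depth (shiftedDegree K 𝒜 n) = n`.
* "`∫ : A → K` … an isomorphism in degree `2n` and zero in all other degrees": a linear form `∫ : A →ₗ[K] K`; the
  theorems below only use "zero in all other degrees" (`∀ i ≠ 2n, ∀ x ∈ A_i, ∫ x = 0`), stated as a hypothesis.
* "`φ(a, b) := (-1)^q ∫(ab)` if `a` is homogeneous of degree `n + 2q` or `n + 2q + 1`": `q = ⌊(i - n)/2⌋` for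
  `a ∈ A_i`; the sign `(-1)^q = (-1)^{|q|}` is the diagonal operator `lefschetzSign K 𝒜 n` (acting by
  `(-1)^{|⌊(i-n)/2⌋|}` on `A_i`), and `φ = lefschetzForm K 𝒜 n ∫ : LinearMap.BilinForm K A`,
  `φ a b = ∫ (lefschetzSign a * b)` (`lefschetzForm_apply_of_mem`: `φ a b = (-1)^{|q|} ∫(ab)` for `a ∈ A_i`).
* "invariant" ((1.3): `φ(e_a m, m') + φ(m, e_a m') = 0` for `a ∈ A_2`, and `φ = 0` on `A[n]_k × A[n]_l` unless
  `k + l = 0`, i.e. `h` is skew): `lefschetzForm_mul_add_eq_zero`, `isSkewAdjoint_lefschetzForm_mul`,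
  `lefschetzForm_shiftedDegree_add_eq_zero`, `isSkewAdjoint_lefschetzForm_shiftedDegree`.
* "`(-)^n`-symmetric": `lefschetzForm_comm : φ b a = (-1)^n φ a b`.
* "the form `(a, b) ↦ ∫(ab)`": `(LinearMap.mul K A).compr₂ ∫`; "nondegenerate": Mathlib `LinearMap.Nondegenerate`
  (left- and right-separating).

## Contents (all proved)

* §1 `gradedScalar` (the diagonal operator with prescribed scalars on the `A_i`) and `gradedScalar_apply_of_mem`;
  `shiftedDegree` with `shiftedDegree_apply_of_mem`, `le_degreeSpace_shiftedDegree`, **`isZGrading_shiftedDegree`**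
  (`A[n]` is `ℤ`-graded), **`degreeSpace_shiftedDegree_eq`** (`A[n]_{i-n} = A_i`, characteristic `0`),
  `degreeSpace_shiftedDegree_eq_bot` (no other degrees).
* §2 `mulLeftDegTwo` (`A_2 ⊆ 𝔤𝔩(A)`), **`lie_shiftedDegree_mul`** (`[h, L_a] = 2 L_a` for `a ∈ A_2`: "homogeneous of
  degree two"), `mulLeftDegTwo_le_adDegree`; `IsGradedCommutative`, `IsGradedCommutative.mul_comm_of_even` (even
  elements are central among homogeneous ones), **`IsGradedCommutative.lie_mul_mul_eq_zero`** ("abelian").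
* §3 **`IsLefschetzAlgebra`** (the printed definition) and the constructor **`IsLefschetzAlgebra.mk'`** from the two
  substantive conditions (some `L_a`, `a ∈ A_2`, is a Lefschetz operator; `𝔤(A_2, A[n])` is semisimple) — the grading,
  degree-two and commutation conditions of A1-88 being automatic (§1–§2); `IsLefschetzAlgebra.exists_hasLefschetzProperty`
  (some `a ∈ A_2` multiplies with the Lefschetz property), **`IsLefschetzAlgebra.bijOn_pow_mul`** (the Lefschetz
  isomorphisms `a^k · : A_{n-k} ≅ A_{n+k}`, `k ≤ n`).
* §4 `lefschetzSign`, `lefschetzSign_apply_of_mem`, `lefschetzSign_lefschetzSign` (`ε² = 1`), `lefschetzForm`,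
  `lefschetzForm_apply_of_mem`; **invariance** `lefschetzForm_mul_add_eq_zero` / `isSkewAdjoint_lefschetzForm_mul`
  (under graded-commutativity), `lefschetzForm_apply_eq_zero_of_ne` (`φ(A_i, A_j) = 0` unless `i + j = 2n`),
  `lefschetzForm_shiftedDegree_add_eq_zero` / `isSkewAdjoint_lefschetzForm_shiftedDegree`; **symmetry**
  `lefschetzForm_comm` (`φ(b, a) = (-1)^n φ(a, b)`, with the parity lemma `neg_one_pow_lefschetzSign_symm`);
  **non-degeneracy transfer** `nondegenerate_lefschetzForm_iff` ("then the form `(a, b) ↦ ∫(ab)` is also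
  nondegenerate" — in fact equivalent) and `mul_compr₂_apply_mul` (`∫((ab)c) = ∫(a(bc))`, the Frobenius
  associativity); `IsLefschetzAlgebra.isSkewAdjoint_of_mem` (`A_2 ⊆ 𝔞𝔲𝔱(A[n], φ)` in a Lefschetz algebra).
* §5 (rider A1-122) `IsLefschetzAlgebra.depth_pos` (`n ≥ 1`, see STANDING ASSUMPTIONS); `lefschetzForm_ne_zero`
  (`φ ≠ 0` once `∫` does not vanish on `A_{2n}`); **`IsLefschetzAlgebra.nondegenerate_lefschetzForm_of_isIrreducible`**
  — the parenthetical "(which is for instance the case when `A[n]` is irreducible as a Lefschetz module)": for `A[n]`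
  irreducible over `𝔤(A_2, A[n])` and `∫` vanishing off degree `2n` but not on `A_{2n}`, `φ` is non-degenerate (a
  non-zero invariant form on an irreducible Lefschetz module, A1-120
  `IsLefschetzModule.nondegenerate_of_isIrreducible`; any field of characteristic `0`); and
  **`IsLefschetzAlgebra.nondegenerate_mul_compr₂_of_isIrreducible`** ("then the form `(a, b) ↦ ∫(ab)` is also
  nondegenerate and so `A` becomes a Frobenius algebra").

## SCOPE (what is NOT formalised here)

(a) [Formalised by rider A1-122, §5: the parenthetical "(which is for instance the case when `A[n]` is irreducible
as a Lefschetz module)", via A1-120 `LefschetzModuleInvariantFormIrreducible.lean`.]  (b) "Frobenius algebra (in the graded sense)" is not introduced as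
a notion; only the non-degeneracy and associativity of `(a, b) ↦ ∫(ab)` are recorded.  (c) The examples ((1.9): "It
is equivalent to say that the cohomology algebra of `X` is a Lefschetz algebra"; complex tori, whose cohomology
algebra is an exterior algebra — Mathlib `ExteriorAlgebra.gradedAlgebra`) are left to the lane's geometric files;
nothing here concerns complex tori or the Hodge conjecture.  (d) `∫` is a parameter; its bijectivity on `A_{2n}` is
not used by the theorems of §4 and is therefore not assumed.

## References

* [LooijengaLunts1997] E. Looijenga, V. A. Lunts, *A Lie algebra attached to a projective variety*, Invent. Math. 129
  (1997) 361–412; arXiv:alg-geom/9604014. §1 (1.4), p. 5 L17–L29 of the held TeX text; (1.1) p. 4, (1.3) p. 7.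
-/

namespace Literature.Algebra.Lie

open Module Function Set DirectSum

-- The commutator Lie ring of `𝔤𝔩(A) = Module.End K A`: Mathlib's reducible NON-instance, enabled file-locally
-- exactly as in `LefschetzModule.lean`.
attribute [local instance 100] LieRing.ofAssociativeRing

/-! ### §1 The shifted grading `A[n]`: the degree operator `h` -/

section Grading

variable (K : Type*) [Field K] {A : Type*} [Ring A] [Algebra K A] (𝒜 : ℕ → Submodule K A) [GradedAlgebra 𝒜]

/-- The diagonal operator of `𝔤𝔩(A)` acting by the scalar `c i` on the graded piece `A_i` of a graded algebra
`A = ⊕ A_i` (used for the degree operator of `A[n]` and for the sign `(-1)^q` of (1.4)).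
[cite: LooijengaLunts1997, §1 (1.1) p. 3 L106–L108 ("denote by h : M → M the transformation that is multiplication by k in degree k")] -/
noncomputable def gradedScalar (c : ℕ → K) : Module.End K A :=
  (DirectSum.toModule K ℕ A fun i ↦ c i • (𝒜 i).subtype) ∘ₗ
    (DirectSum.decomposeLinearEquiv 𝒜 : A ≃ₗ[K] ⨁ i, 𝒜 i).toLinearMap

/-- `gradedScalar c` is multiplication by `c i` on `A_i`. [cite: LooijengaLunts1997, §1 (1.1) p. 3 L106–L108] -/
theorem gradedScalar_apply_of_mem (c : ℕ → K) {i : ℕ} {x : A} (hx : x ∈ 𝒜 i) :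
    gradedScalar K 𝒜 c x = c i • x := by
  have h1 : (DirectSum.decomposeLinearEquiv 𝒜 : A ≃ₗ[K] ⨁ i, 𝒜 i) x =
      DirectSum.lof K ℕ (fun i ↦ 𝒜 i) i ⟨x, hx⟩ :=
    DirectSum.decomposeLinearEquiv_apply_coe 𝒜 i ⟨x, hx⟩
  rw [gradedScalar, LinearMap.comp_apply, LinearEquiv.coe_toLinearMap, h1, DirectSum.toModule_lof,
    LinearMap.smul_apply, Submodule.subtype_apply]

/-- **The degree operator `h` of the shifted graded space `A[n]`** (`A[n]_k = A_{k+n}`): multiplication by `i - n`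
on `A_i`. [cite: LooijengaLunts1997, §1 (1.4) p. 5 L19–L20 ("A[n] is a Lefschetz module of depth n over A_2")]
[cite: LooijengaLunts1997, §1 (1.1) p. 3 L106–L108] -/
noncomputable def shiftedDegree (n : ℕ) : Module.End K A :=
  gradedScalar K 𝒜 fun i ↦ (((i : ℤ) - n : ℤ) : K)

/-- `h x = (i - n) x` for `x ∈ A_i`. [cite: LooijengaLunts1997, §1 (1.4) p. 5 L19–L20] -/
theorem shiftedDegree_apply_of_mem (n : ℕ) {i : ℕ} {x : A} (hx : x ∈ 𝒜 i) :
    shiftedDegree K 𝒜 n x = (((i : ℤ) - n : ℤ) : K) • x :=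
  gradedScalar_apply_of_mem K 𝒜 _ hx

/-- `A_i ⊆ A[n]_{i-n}` (the degree-`(i - n)` part of `(A, h)`). [cite: LooijengaLunts1997, §1 (1.4) p. 5 L19–L20] -/
theorem le_degreeSpace_shiftedDegree (n i : ℕ) : 𝒜 i ≤ degreeSpace (shiftedDegree K 𝒜 n) ((i : ℤ) - n) :=
  fun _ hx ↦ mem_degreeSpace_iff.2 (shiftedDegree_apply_of_mem K 𝒜 n hx)

/-- **`A[n]` is `ℤ`-graded by `h`** (in the sense of A1-88 `IsZGrading`: `⊕ₖ A[n]_k = A`).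
[cite: LooijengaLunts1997, §1 (1.4) p. 5 L19–L20] [cite: LooijengaLunts1997, §1 (1.1) p. 3 L106–L108] -/
theorem isZGrading_shiftedDegree (n : ℕ) : IsZGrading (shiftedDegree K 𝒜 n) := by
  rw [IsZGrading, eq_top_iff, ← (DirectSum.Decomposition.isInternal 𝒜).submodule_iSup_eq_top]
  exact iSup_le fun i ↦ (le_degreeSpace_shiftedDegree K 𝒜 n i).trans
    (le_iSup (fun k : ℤ ↦ degreeSpace (shiftedDegree K 𝒜 n) k) ((i : ℤ) - n))

variable [CharZero K]

/-- **`A[n]_{i-n} = A_i`**: the degree parts of `(A, h)` are exactly the graded pieces (characteristic `0`: the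
`A_i` sit in eigenspaces of `h` for distinct eigenvalues and span `A`).
[cite: LooijengaLunts1997, §1 (1.4) p. 5 L19–L20] [cite: LooijengaLunts1997, §1 (1.1) p. 3 L106–L108] -/
theorem degreeSpace_shiftedDegree_eq (n i : ℕ) : degreeSpace (shiftedDegree K 𝒜 n) ((i : ℤ) - n) = 𝒜 i := by
  classical
  refine le_antisymm (fun x hx ↦ ?_) (le_degreeSpace_shiftedDegree K 𝒜 n i)
  -- `x - x_i` lies in the span of the other eigenspaces and in the eigenspace of `i - n`
  set xi : A := (DirectSum.decompose 𝒜 x i : A) with hxi_def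
  have hxi : xi ∈ 𝒜 i := (DirectSum.decompose 𝒜 x i).2
  have hE : ∀ j : ℕ, 𝒜 j ≤ Module.End.eigenspace (shiftedDegree K 𝒜 n) (((j : ℤ) - n : ℤ) : K) :=
    fun j ↦ le_degreeSpace_shiftedDegree K 𝒜 n j
  have hrest : x - xi ∈ ⨆ j : ℕ, ⨆ (_ : j ≠ i), 𝒜 j := by
    have hsum := DirectSum.sum_support_decompose 𝒜 x
    have h1 : x - xi = ∑ j ∈ (DirectSum.decompose 𝒜 x).support.erase i, (DirectSum.decompose 𝒜 x j : A) := by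
      by_cases hi : i ∈ (DirectSum.decompose 𝒜 x).support
      · rw [sub_eq_iff_eq_add']
        exact ((Finset.add_sum_erase _ (fun j ↦ (DirectSum.decompose 𝒜 x j : A)) hi).trans hsum).symm
      · have h0 : xi = 0 := by
          rw [hxi_def]
          have := DFinsupp.notMem_support_iff.1 hi
          rw [this, ZeroMemClass.coe_zero]
        rw [h0, sub_zero, Finset.erase_eq_of_notMem hi]
        exact hsum.symm
    rw [h1]
    refine Submodule.sum_mem _ fun j hj ↦ ?_
    exact Submodule.mem_iSup_of_mem j (Submodule.mem_iSup_of_mem (Finset.ne_of_mem_erase hj)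
      (DirectSum.decompose 𝒜 x j).2)
  have hle : (⨆ j : ℕ, ⨆ (_ : j ≠ i), 𝒜 j) ≤ ⨆ μ : K, ⨆ (_ : μ ≠ (((i : ℤ) - n : ℤ) : K)),
      Module.End.eigenspace (shiftedDegree K 𝒜 n) μ := by
    refine iSup₂_le fun j hj ↦ (hE j).trans ?_
    refine le_iSup₂_of_le (f := fun μ (_ : μ ≠ (((i : ℤ) - n : ℤ) : K)) ↦
      Module.End.eigenspace (shiftedDegree K 𝒜 n) μ) (((j : ℤ) - n : ℤ) : K) (fun hji ↦ hj ?_) le_rfl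
    have := Int.cast_injective (α := K) hji
    omega
  have hrest' := hle hrest
  have hmem : x - xi ∈ Module.End.eigenspace (shiftedDegree K 𝒜 n) (((i : ℤ) - n : ℤ) : K) :=
    Submodule.sub_mem _ hx (hE i hxi)
  have h0 : x - xi = 0 :=
    Submodule.disjoint_def.1 ((Module.End.eigenspaces_iSupIndep (shiftedDegree K 𝒜 n)).disjoint_biSup
      (y := {μ | μ ≠ (((i : ℤ) - n : ℤ) : K)}) (fun h ↦ h rfl)) _ hmem (by simpa only [Set.mem_setOf_eq] using hrest')
  rw [sub_eq_zero] at h0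
  rw [h0]
  exact hxi

/-- … and **`A[n]_m = 0` for the other `m`** (`m ≠ i - n` for all `i`, i.e. `m < -n`). [cite: LooijengaLunts1997, §1 (1.4) p. 5 L19–L20] -/
theorem degreeSpace_shiftedDegree_eq_bot (n : ℕ) {m : ℤ} (hm : ∀ i : ℕ, m ≠ (i : ℤ) - n) :
    degreeSpace (shiftedDegree K 𝒜 n) m = ⊥ := by
  have hE : ∀ j : ℕ, 𝒜 j ≤ Module.End.eigenspace (shiftedDegree K 𝒜 n) (((j : ℤ) - n : ℤ) : K) :=
    fun j ↦ le_degreeSpace_shiftedDegree K 𝒜 n j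
  have htop : (⊤ : Submodule K A) ≤ ⨆ μ : K, ⨆ (_ : μ ≠ (m : K)), Module.End.eigenspace (shiftedDegree K 𝒜 n) μ := by
    rw [← (DirectSum.Decomposition.isInternal 𝒜).submodule_iSup_eq_top]
    refine iSup_le fun j ↦ (hE j).trans ?_
    refine le_iSup₂_of_le (f := fun μ (_ : μ ≠ (m : K)) ↦ Module.End.eigenspace (shiftedDegree K 𝒜 n) μ)
      (((j : ℤ) - n : ℤ) : K) (fun hjm ↦ hm j ?_) le_rfl
    exact (Int.cast_injective (α := K) hjm).symm
  have hdis := (Module.End.eigenspaces_iSupIndep (shiftedDegree K 𝒜 n)).disjoint_biSup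
    (y := {μ | μ ≠ (m : K)}) (fun h ↦ h rfl)
  rw [eq_bot_iff]
  intro x hx
  have h0 := Submodule.disjoint_def.1 hdis x hx (by simpa only [Set.mem_setOf_eq] using htop Submodule.mem_top)
  rw [h0]
  exact Submodule.zero_mem _

end Grading

/-! ### §2 "over `A_2`": the multiplications `L_a`, `a ∈ A_2`, and graded-commutativity -/

section DegreeTwo

variable (K : Type*) [Field K] {A : Type*} [Ring A] [Algebra K A] (𝒜 : ℕ → Submodule K A)

/-- **`A_2` acting on `A` by multiplication**: the subspace `{L_a | a ∈ A_2}` of `𝔤𝔩(A)` (the image of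
`e : A_2 → 𝔤𝔩(A[n])`, `e_a(x) = ax`). [cite: LooijengaLunts1997, §1 (1.4) p. 5 L19–L20 ("over A_2")]
[cite: LooijengaLunts1997, §1 (1.1) p. 4 L28–L31] -/
def mulLeftDegTwo : Submodule K (Module.End K A) := (𝒜 2).map (LinearMap.mul K A)

/-- Membership in `{L_a | a ∈ A_2}`. [cite: LooijengaLunts1997, §1 (1.4) p. 5 L19–L20] -/
theorem mem_mulLeftDegTwo_iff {u : Module.End K A} :
    u ∈ mulLeftDegTwo K 𝒜 ↔ ∃ a ∈ 𝒜 2, LinearMap.mul K A a = u := Submodule.mem_map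

/-- `L_a ∈ {L_a | a ∈ A_2}`. [cite: LooijengaLunts1997, §1 (1.4) p. 5 L19–L20] -/
theorem mul_mem_mulLeftDegTwo {a : A} (ha : a ∈ 𝒜 2) : LinearMap.mul K A a ∈ mulLeftDegTwo K 𝒜 :=
  Submodule.mem_map_of_mem ha

/-- **"graded-commutative"**: `y x = (-1)^{ij} x y` for `x ∈ A_i`, `y ∈ A_j`. [cite: LooijengaLunts1997, §1 (1.4) p. 5 L18 ("a graded-commutative algebra")] -/
structure IsGradedCommutative : Prop where
  /-- `y x = (-1)^{ij} x y` for `x ∈ A_i`, `y ∈ A_j` -/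
  mul_comm' : ∀ ⦃i j : ℕ⦄ ⦃x y : A⦄, x ∈ 𝒜 i → y ∈ 𝒜 j → y * x = ((-1 : K) ^ (i * j)) • (x * y)

variable {K 𝒜}

/-- Unfolding `IsGradedCommutative`. [cite: LooijengaLunts1997, §1 (1.4) p. 5 L18] -/
theorem isGradedCommutative_iff : IsGradedCommutative K 𝒜 ↔
    ∀ ⦃i j : ℕ⦄ ⦃x y : A⦄, x ∈ 𝒜 i → y ∈ 𝒜 j → y * x = ((-1 : K) ^ (i * j)) • (x * y) :=
  ⟨fun h ↦ h.mul_comm', fun h ↦ ⟨h⟩⟩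

/-- In a graded-commutative algebra an element of EVEN degree commutes with every homogeneous element.
[cite: LooijengaLunts1997, §1 (1.4) p. 5 L18] -/
theorem IsGradedCommutative.mul_comm_of_even (hc : IsGradedCommutative K 𝒜) {i j : ℕ} (hi : Even i) {x y : A}
    (hx : x ∈ 𝒜 i) (hy : y ∈ 𝒜 j) : y * x = x * y := by
  rw [hc.mul_comm' hx hy, Even.neg_one_pow (hi.mul_right j), one_smul]

/-- **"abelian"**: the multiplications `L_a`, `L_b` by degree-two elements commute, `[L_a, L_b] = 0`.
[cite: LooijengaLunts1997, §1 (1.1) p. 4 L28–L29 ("graded abelian Lie algebra")] [cite: LooijengaLunts1997, §1 (1.4) p. 5 L18–L20] -/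
theorem IsGradedCommutative.lie_mul_mul_eq_zero (hc : IsGradedCommutative K 𝒜) {a b : A} (ha : a ∈ 𝒜 2)
    (hb : b ∈ 𝒜 2) : ⁅LinearMap.mul K A a, LinearMap.mul K A b⁆ = 0 := by
  have hab : a * b = b * a := (hc.mul_comm_of_even (by decide) hb ha)
  ext x
  simp only [Ring.lie_def, LinearMap.sub_apply, Module.End.mul_apply, LinearMap.mul_apply', LinearMap.zero_apply,
    ← mul_assoc, hab, sub_self]

/-- So `{L_a | a ∈ A_2}` is an abelian family. [cite: LooijengaLunts1997, §1 (1.1) p. 4 L28–L29] -/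
theorem IsGradedCommutative.lie_eq_zero_of_mem (hc : IsGradedCommutative K 𝒜) :
    ∀ u ∈ mulLeftDegTwo K 𝒜, ∀ v ∈ mulLeftDegTwo K 𝒜, ⁅u, v⁆ = 0 := by
  rintro u ⟨a, ha, rfl⟩ v ⟨b, hb, rfl⟩
  exact hc.lie_mul_mul_eq_zero ha hb

end DegreeTwo

section DegreeTwoGraded

variable (K : Type*) [Field K] {A : Type*} [Ring A] [Algebra K A] (𝒜 : ℕ → Submodule K A) [GradedAlgebra 𝒜]

/-- **`[h, L_a] = 2 L_a` for `a ∈ A_2`**: multiplication by a degree-two element has degree `2` on `A[n]` ("we regard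
`𝔞` as a graded abelian Lie algebra which is homogeneous of degree two").
[cite: LooijengaLunts1997, §1 (1.1) p. 4 L28–L29] [cite: LooijengaLunts1997, §1 (1.4) p. 5 L19–L20] -/
theorem lie_shiftedDegree_mul (n : ℕ) {a : A} (ha : a ∈ 𝒜 2) :
    ⁅shiftedDegree K 𝒜 n, LinearMap.mul K A a⁆ = 2 • LinearMap.mul K A a := by
  refine DirectSum.decompose_lhom_ext 𝒜 fun i ↦ ?_
  ext ⟨x, hx⟩
  have hax : a * x ∈ 𝒜 (2 + i) := SetLike.mul_mem_graded ha hx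
  simp only [LinearMap.comp_apply, Submodule.subtype_apply, Ring.lie_def, LinearMap.sub_apply,
    Module.End.mul_apply, LinearMap.mul_apply', LinearMap.smul_apply]
  rw [shiftedDegree_apply_of_mem K 𝒜 n hax, shiftedDegree_apply_of_mem K 𝒜 n hx, mul_smul_comm, ← sub_smul,
    two_smul, ← two_smul K (a * x)]
  congr 1
  push_cast
  ring

/-- Hence `{L_a | a ∈ A_2} ⊆ 𝔤𝔩(A[n])₂`. [cite: LooijengaLunts1997, §1 (1.1) p. 4 L28–L29] -/
theorem mulLeftDegTwo_le_adDegree (n : ℕ) : mulLeftDegTwo K 𝒜 ≤ adDegree K (shiftedDegree K 𝒜 n) 2 := by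
  rintro u ⟨a, ha, rfl⟩
  rw [mem_adDegree_iff, ofNat_smul_eq_nsmul]
  exact lie_shiftedDegree_mul K 𝒜 n ha

variable {K 𝒜}

/-- An element of even degree of a graded-commutative algebra commutes with every element (decompose into
homogeneous components). [cite: LooijengaLunts1997, §1 (1.4) p. 5 L18] -/
theorem IsGradedCommutative.commute_of_even (hc : IsGradedCommutative K 𝒜) {i : ℕ} (hi : Even i) {x : A}
    (hx : x ∈ 𝒜 i) (y : A) : Commute x y := by
  induction y using DirectSum.Decomposition.inductionOn 𝒜 with
  | zero => exact Commute.zero_right x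
  | homogeneous y => exact (hc.mul_comm_of_even hi hx y.2).symm
  | add y y' hy hy' => exact hy.add_right hy'

end DegreeTwoGraded

/-! ### §3 Lefschetz algebras -/

section LefschetzAlgebra

variable (K : Type*) [Field K] {A : Type*} [Ring A] [Algebra K A] (𝒜 : ℕ → Submodule K A) [GradedAlgebra 𝒜]

/-- **A Lefschetz algebra of depth `n`.**  Printed: "Let `A = ⊕_{i=0}^{2n} A_i` be a graded-commutative algebra
with `A_0 = K`. We say that `A` is a Lefschetz algebra of depth `n` if `A[n]` is a Lefschetz module of depth `n` over
`A_2`."  Rendered on a Mathlib-graded `K`-algebra `(A, 𝒜)`: graded-commutative; `A_0 = K · 1`; `A_i = 0` for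
`i > 2n`; `(A, h)` with `h = i - n` on `A_i` is a Lefschetz module over `{L_a | a ∈ A_2}` in the sense of A1-88
(`IsLefschetzModule`); and its depth is `n` (i.e. `A_{2n} ≠ 0`).  The rendering forces `n ≥ 1` (`depth_pos`: for
`n = 0`, `h = 0`, excluded by A1-88's `h ≠ 0`), the paper being silent on depth `0`; its standing assumptions
(`K` of characteristic `0`, `A` finite-dimensional) are hypotheses of the theorems, not fields of the structure.
[cite: LooijengaLunts1997, §1 (1.4) p. 5 L17–L20] -/
structure IsLefschetzAlgebra (n : ℕ) : Prop where
  /-- "a graded-commutative algebra" -/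
  isGradedCommutative : IsGradedCommutative K 𝒜
  /-- "with `A_0 = K`" -/
  exists_algebraMap_eq : ∀ x ∈ 𝒜 0, ∃ c : K, algebraMap K A c = x
  /-- "`A = ⊕_{i=0}^{2n} A_i`": no degrees beyond `2n` -/
  eq_bot_of_lt : ∀ i : ℕ, 2 * n < i → 𝒜 i = ⊥
  /-- "`A[n]` is a Lefschetz module … over `A_2`" -/
  isLefschetzModule : IsLefschetzModule K (shiftedDegree K 𝒜 n) (mulLeftDegTwo K 𝒜)
  /-- "… of depth `n`" -/
  depth_eq : depth (shiftedDegree K 𝒜 n) = n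

variable {K 𝒜}

/-- **Constructor.**  For a graded-commutative `A = ⊕_{i ≤ 2n} A_i` with `A_0 = K`, the grading / degree-two /
commutation requirements of a Lefschetz module (A1-88) hold automatically (§1–§2); it remains that SOME `L_a`,
`a ∈ A_2`, be a Lefschetz operator on `A[n]` (the domain of `f` is non-empty), that `𝔤(A_2, A[n])` be semisimple, and
that the depth be `n`. [cite: LooijengaLunts1997, §1 (1.4) p. 5 L17–L20] [cite: LooijengaLunts1997, §1 (1.1) p. 4 L28–L37, L56–L58] -/
theorem IsLefschetzAlgebra.mk' {n : ℕ} (hc : IsGradedCommutative K 𝒜) (h0 : ∀ x ∈ 𝒜 0, ∃ c : K, algebraMap K A c = x)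
    (htop : ∀ i : ℕ, 2 * n < i → 𝒜 i = ⊥)
    (hne : (lefschetzDomain K (shiftedDegree K 𝒜 n) (mulLeftDegTwo K 𝒜)).Nonempty)
    (hss : LieAlgebra.IsSemisimple K (lefschetzLieAlgebra K (shiftedDegree K 𝒜 n) (mulLeftDegTwo K 𝒜)))
    (hd : depth (shiftedDegree K 𝒜 n) = n) : IsLefschetzAlgebra K 𝒜 n where
  isGradedCommutative := hc
  exists_algebraMap_eq := h0
  eq_bot_of_lt := htop
  isLefschetzModule :=
    { isZGrading := isZGrading_shiftedDegree K 𝒜 n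
      le_adDegree_two := mulLeftDegTwo_le_adDegree K 𝒜 n
      lie_eq_zero := hc.lie_eq_zero_of_mem
      nonempty_lefschetzDomain := hne
      isSemisimple := hss }
  depth_eq := hd

namespace IsLefschetzAlgebra

variable {n : ℕ}

/-- `A[n]` is `ℤ`-graded. [cite: LooijengaLunts1997, §1 (1.4) p. 5 L19–L20] -/
theorem isZGrading (_L : IsLefschetzAlgebra K 𝒜 n) : IsZGrading (shiftedDegree K 𝒜 n) :=
  isZGrading_shiftedDegree K 𝒜 n

/-- In a Lefschetz algebra the degree operator of `A[n]` is non-zero (`A ≠ A_n`). [cite: LooijengaLunts1997, §1 (1.4) p. 5 L19–L20] -/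
theorem shiftedDegree_ne_zero (L : IsLefschetzAlgebra K 𝒜 n) : shiftedDegree K 𝒜 n ≠ 0 :=
  L.isLefschetzModule.h_ne_zero

variable [CharZero K] [FiniteDimensional K A]

/-- **Some degree-two element `a ∈ A_2` multiplies with the Lefschetz property on `A[n]`**:
`L_a^k : A_{n-k} ≅ A_{n+k}` — by (1.1) (A1-88 `mem_lefschetzDomain_iff_hasLefschetzProperty`).
[cite: LooijengaLunts1997, §1 (1.4) p. 5 L19–L20] [cite: LooijengaLunts1997, §1 (1.1) p. 4 L30–L31] -/
theorem exists_hasLefschetzProperty (L : IsLefschetzAlgebra K 𝒜 n) :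
    ∃ a ∈ 𝒜 2, HasLefschetzProperty (shiftedDegree K 𝒜 n) (LinearMap.mul K A a) := by
  obtain ⟨u, hu, Lu⟩ := L.isLefschetzModule.exists_hasLefschetzProperty
  obtain ⟨a, ha, rfl⟩ := (mem_mulLeftDegTwo_iff K 𝒜).1 hu
  exact ⟨a, ha, Lu⟩

omit [CharZero K] [FiniteDimensional K A] in
/-- The multiplication by a Lefschetz `a ∈ A_2`, `k` times, maps `A_i` into `A_{i + 2k}` — in the language of
`A[n]`: `L_a^k (A[n]_m) ⊆ A[n]_{m+2k}`. [cite: LooijengaLunts1997, §1 (1.1) p. 4 L1–L2] -/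
theorem pow_mul_apply_mem {a : A} (La : HasLefschetzProperty (shiftedDegree K 𝒜 n) (LinearMap.mul K A a)) {i : ℕ}
    {x : A} (hx : x ∈ 𝒜 i) (k : ℕ) :
    (LinearMap.mul K A a ^ k) x ∈ degreeSpace (shiftedDegree K 𝒜 n) ((i : ℤ) - n + 2 * k) :=
  pow_apply_mem_degreeSpace La.mapsTo (le_degreeSpace_shiftedDegree K 𝒜 n i hx) k

omit [FiniteDimensional K A] in
/-- **The Lefschetz isomorphisms of a Lefschetz algebra: `a^k · : A_{n-k} → A_{n+k}` is a bijection** for a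
Lefschetz `a ∈ A_2` and `k ≤ n` ("for all integers `k ≥ 0`, `e^k` maps `M_{-k}` isomorphically onto `M_k`",
`M = A[n]`). [cite: LooijengaLunts1997, §1 (1.1) p. 4 L1–L2] [cite: LooijengaLunts1997, §1 (1.4) p. 5 L19–L20] -/
theorem bijOn_pow_mul {a : A} (La : HasLefschetzProperty (shiftedDegree K 𝒜 n) (LinearMap.mul K A a)) {k : ℕ}
    (hk : k ≤ n) : BijOn (⇑(LinearMap.mul K A a ^ k)) (𝒜 (n - k)) (𝒜 (n + k)) := by
  have h1 := La.bijOn k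
  have e1 : (-(k : ℤ)) = ((n - k : ℕ) : ℤ) - n := by omega
  have e2 : (k : ℤ) = ((n + k : ℕ) : ℤ) - n := by push_cast; ring
  rw [e1, e2, degreeSpace_shiftedDegree_eq K 𝒜 n (n - k), degreeSpace_shiftedDegree_eq K 𝒜 n (n + k)] at h1
  exact h1

end IsLefschetzAlgebra

end LefschetzAlgebra

/-! ### §4 The invariant `(-1)^n`-symmetric form `φ(a, b) = (-1)^q ∫(ab)` -/

section Form

variable (K : Type*) [Field K] {A : Type*} [Ring A] [Algebra K A] (𝒜 : ℕ → Submodule K A) [GradedAlgebra 𝒜]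

/-- **The sign `(-1)^q` of (1.4)** as a diagonal operator `ε` on `A`: on `A_i`, with `i = n + 2q` or
`i = n + 2q + 1` (i.e. `q = ⌊(i - n)/2⌋ ∈ ℤ`), it is multiplication by `(-1)^q = (-1)^{|q|}`.
[cite: LooijengaLunts1997, §1 (1.4) p. 5 L23–L25 ("φ(a, b) := (-1)^q ∫(ab) if a is homogeneous of degree n + 2q or n + 2q + 1")] -/
noncomputable def lefschetzSign (n : ℕ) : Module.End K A :=
  gradedScalar K 𝒜 fun i ↦ (-1 : K) ^ (((i : ℤ) - n) / 2).natAbs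

/-- `ε x = (-1)^{|⌊(i-n)/2⌋|} x` for `x ∈ A_i`. [cite: LooijengaLunts1997, §1 (1.4) p. 5 L23–L25] -/
theorem lefschetzSign_apply_of_mem (n : ℕ) {i : ℕ} {x : A} (hx : x ∈ 𝒜 i) :
    lefschetzSign K 𝒜 n x = ((-1 : K) ^ (((i : ℤ) - n) / 2).natAbs) • x :=
  gradedScalar_apply_of_mem K 𝒜 _ hx

/-- `ε (ε x) = x` (`(-1)^q (-1)^q = 1`). [cite: LooijengaLunts1997, §1 (1.4) p. 5 L23–L25] -/
theorem lefschetzSign_lefschetzSign (n : ℕ) (x : A) : lefschetzSign K 𝒜 n (lefschetzSign K 𝒜 n x) = x := by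
  induction x using DirectSum.Decomposition.inductionOn 𝒜 with
  | zero => rw [map_zero, map_zero]
  | homogeneous x =>
    rw [lefschetzSign_apply_of_mem K 𝒜 n x.2, map_smul, lefschetzSign_apply_of_mem K 𝒜 n x.2, smul_smul,
      ← pow_add, ← two_mul, pow_mul, neg_one_sq, one_pow, one_smul]
  | add x y hx hy => rw [map_add, map_add, hx, hy]

/-- **The form `φ` of (1.4)**: `φ(a, b) = ∫(ε(a) b)`, i.e. `φ(a, b) = (-1)^q ∫(ab)` for `a` homogeneous of degree
`n + 2q` or `n + 2q + 1`, for a linear form `∫ : A → K` ("let `∫ : A → K` be a linear form that is an isomorphism in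
degree `2n` and zero in all other degrees and define `φ(a, b) := (-1)^q ∫(ab)` …").
[cite: LooijengaLunts1997, §1 (1.4) p. 5 L21–L25] -/
noncomputable def lefschetzForm (n : ℕ) (intg : A →ₗ[K] K) : LinearMap.BilinForm K A :=
  (LinearMap.mul K A ∘ₗ lefschetzSign K 𝒜 n).compr₂ intg

/-- `φ(a, b) = ∫(ε(a) b)`. [cite: LooijengaLunts1997, §1 (1.4) p. 5 L21–L25] -/
theorem lefschetzForm_apply (n : ℕ) (intg : A →ₗ[K] K) (a b : A) :
    lefschetzForm K 𝒜 n intg a b = intg (lefschetzSign K 𝒜 n a * b) := rfl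

/-- **`φ(a, b) = (-1)^q ∫(ab)` for `a ∈ A_i`, `q = ⌊(i-n)/2⌋`** (with `(-1)^q` written `(-1)^{|q|}`).
[cite: LooijengaLunts1997, §1 (1.4) p. 5 L23–L25] -/
theorem lefschetzForm_apply_of_mem (n : ℕ) (intg : A →ₗ[K] K) {i : ℕ} {a : A} (ha : a ∈ 𝒜 i) (b : A) :
    lefschetzForm K 𝒜 n intg a b = ((-1 : K) ^ (((i : ℤ) - n) / 2).natAbs) • intg (a * b) := by
  rw [lefschetzForm_apply, lefschetzSign_apply_of_mem K 𝒜 n ha, smul_mul_assoc, map_smul]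

variable {K 𝒜}

/-- Two powers of `-1` with exponents of the same parity agree (plumbing; the tree's
`Literature.MathematicalPhysics.QuantumLattice.neg_one_pow_eq_neg_one_pow_of_mod_two` is the same statement in an
unrelated module, not imported here). [folklore] -/
private theorem neg_one_pow_eq_of_mod_two_eq {R : Type*} [Ring R] {m m' : ℕ} (h : m % 2 = m' % 2) :
    (-1 : R) ^ m = (-1) ^ m' := by
  rw [neg_one_pow_eq_pow_mod_two m, h, ← neg_one_pow_eq_pow_mod_two m']

/-- `|q| ≡ q (mod 2)`, in the form `omega` digests. [folklore] -/
private theorem natAbs_mod_two (q : ℤ) : q.natAbs % 2 = (q % 2).toNat := by omega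

/-- **Invariance under `A_2`** ("`𝔞` preserves the form `φ` infinitesimally: `φ(e_a m, m') + φ(m, e_a m') = 0`"):
for `A` graded-commutative and `a ∈ A_2`, `φ(ax, y) + φ(x, ay) = 0` — the degree of `ax` is that of `x` plus `2`, so
its sign is the opposite one, while `x a = a x`. [cite: LooijengaLunts1997, §1 (1.4) p. 5 L22 ("invariant")]
[cite: LooijengaLunts1997, §1 (1.3) p. 7 L1–L4] -/
theorem lefschetzForm_mul_add_eq_zero (hc : IsGradedCommutative K 𝒜) (n : ℕ) (intg : A →ₗ[K] K) {a : A}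
    (ha : a ∈ 𝒜 2) (x y : A) :
    lefschetzForm K 𝒜 n intg (a * x) y + lefschetzForm K 𝒜 n intg x (a * y) = 0 := by
  induction x using DirectSum.Decomposition.inductionOn 𝒜 with
  | zero => rw [mul_zero, map_zero, LinearMap.zero_apply, LinearMap.zero_apply, add_zero]
  | @homogeneous i x =>
    have hax : a * (x : A) ∈ 𝒜 (2 + i) := SetLike.mul_mem_graded ha x.2
    have hxa : (x : A) * a = a * x := hc.mul_comm_of_even (by decide) ha x.2
    have hs : ((-1 : K) ^ ((((2 + i : ℕ) : ℤ) - n) / 2).natAbs) = -((-1 : K) ^ (((i : ℤ) - n) / 2).natAbs) := by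
      rw [neg_one_pow_eq_of_mod_two_eq (m' := (((i : ℤ) - n) / 2).natAbs + 1)
        (by rw [natAbs_mod_two, Nat.add_mod, natAbs_mod_two]; omega), pow_succ, mul_neg_one]
    rw [lefschetzForm_apply_of_mem K 𝒜 n intg hax, lefschetzForm_apply_of_mem K 𝒜 n intg x.2, ← mul_assoc, hxa,
      hs, neg_smul, neg_add_cancel]
  | add x x' hx hx' =>
    rw [mul_add, map_add, map_add, LinearMap.add_apply, LinearMap.add_apply, add_add_add_comm, hx, hx', add_zero]

/-- The same invariance in Mathlib's form: `L_a` is skew-adjoint for `φ`. [cite: LooijengaLunts1997, §1 (1.4) p. 5 L22 ("invariant")]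
[cite: LooijengaLunts1997, §1 (1.3) p. 7 L1–L4] -/
theorem isSkewAdjoint_lefschetzForm_mul (hc : IsGradedCommutative K 𝒜) (n : ℕ) (intg : A →ₗ[K] K) {a : A}
    (ha : a ∈ 𝒜 2) : (lefschetzForm K 𝒜 n intg).IsSkewAdjoint (LinearMap.mul K A a) := by
  intro x y
  rw [Pi.neg_apply, map_neg, LinearMap.mul_apply', LinearMap.mul_apply']
  exact eq_neg_of_add_eq_zero_left (lefschetzForm_mul_add_eq_zero hc n intg ha x y)

/-- **`φ(A_i, A_j) = 0` unless `i + j = 2n`** ("`φ` is zero on `M_k × M_l` unless `k + l = 0`", `M = A[n]`), when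
`∫` vanishes outside degree `2n`. [cite: LooijengaLunts1997, §1 (1.4) p. 5 L22–L23] [cite: LooijengaLunts1997, §1 (1.3) p. 7 L1–L2] -/
theorem lefschetzForm_apply_eq_zero_of_ne (n : ℕ) {intg : A →ₗ[K] K}
    (h0 : ∀ i : ℕ, i ≠ 2 * n → ∀ x ∈ 𝒜 i, intg x = 0) {i j : ℕ} (hij : i + j ≠ 2 * n) {x y : A}
    (hx : x ∈ 𝒜 i) (hy : y ∈ 𝒜 j) : lefschetzForm K 𝒜 n intg x y = 0 := by
  rw [lefschetzForm_apply_of_mem K 𝒜 n intg hx, h0 (i + j) hij _ (SetLike.mul_mem_graded hx hy), smul_zero]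

/-- **Invariance under `h`**: `φ(hx, y) + φ(x, hy) = 0` — `φ` pairs `A[n]_k` with `A[n]_{-k}` only.
[cite: LooijengaLunts1997, §1 (1.4) p. 5 L22 ("invariant")] [cite: LooijengaLunts1997, §1 (1.3) p. 7 L1–L2] -/
theorem lefschetzForm_shiftedDegree_add_eq_zero (n : ℕ) {intg : A →ₗ[K] K}
    (h0 : ∀ i : ℕ, i ≠ 2 * n → ∀ x ∈ 𝒜 i, intg x = 0) (x y : A) :
    lefschetzForm K 𝒜 n intg (shiftedDegree K 𝒜 n x) y + lefschetzForm K 𝒜 n intg x (shiftedDegree K 𝒜 n y) = 0 := by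
  induction x using DirectSum.Decomposition.inductionOn 𝒜 with
  | zero => rw [map_zero, map_zero, LinearMap.zero_apply, LinearMap.zero_apply, add_zero]
  | @homogeneous i x =>
    induction y using DirectSum.Decomposition.inductionOn 𝒜 with
    | zero => rw [map_zero, map_zero, map_zero, add_zero]
    | @homogeneous j y =>
      rw [shiftedDegree_apply_of_mem K 𝒜 n x.2, shiftedDegree_apply_of_mem K 𝒜 n y.2]
      simp only [map_smul, LinearMap.smul_apply]
      rw [← add_smul]
      by_cases hij : i + j = 2 * n
      · rw [← Int.cast_add, show ((i : ℤ) - n + ((j : ℤ) - n) : ℤ) = 0 by omega, Int.cast_zero, zero_smul]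
      · rw [lefschetzForm_apply_eq_zero_of_ne n h0 hij x.2 y.2, smul_zero]
    | add y y' hy hy' =>
      rw [map_add, map_add, map_add, add_add_add_comm, hy, hy', add_zero]
  | add x x' hx hx' =>
    rw [map_add, map_add, map_add, LinearMap.add_apply, LinearMap.add_apply, add_add_add_comm, hx, hx', add_zero]

/-- The same in Mathlib's form: `h` is skew-adjoint for `φ`. [cite: LooijengaLunts1997, §1 (1.4) p. 5 L22] [cite: LooijengaLunts1997, §1 (1.3) p. 7 L1–L2] -/
theorem isSkewAdjoint_lefschetzForm_shiftedDegree (n : ℕ) {intg : A →ₗ[K] K}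
    (h0 : ∀ i : ℕ, i ≠ 2 * n → ∀ x ∈ 𝒜 i, intg x = 0) :
    (lefschetzForm K 𝒜 n intg).IsSkewAdjoint (shiftedDegree K 𝒜 n) := by
  intro x y
  rw [Pi.neg_apply, map_neg]
  exact eq_neg_of_add_eq_zero_left (lefschetzForm_shiftedDegree_add_eq_zero n h0 x y)

/-- The parity identity behind the `(-1)^n`-symmetry: for `i + j = 2n`,
`(-1)^{⌊(j-n)/2⌋} (-1)^{ij} = (-1)^n (-1)^{⌊(i-n)/2⌋}`. [cite: LooijengaLunts1997, §1 (1.4) p. 5 L23 ("(−)^n-symmetric")] -/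
theorem neg_one_pow_lefschetzSign_symm {R : Type*} [CommRing R] {i j n : ℕ} (hij : i + j = 2 * n) :
    (-1 : R) ^ (((j : ℤ) - n) / 2).natAbs * (-1) ^ (i * j) = (-1) ^ n * (-1) ^ (((i : ℤ) - n) / 2).natAbs := by
  rcases Nat.even_or_odd i with hi | hi
  · rw [Even.neg_one_pow (hi.mul_right j), mul_one, ← pow_add]
    apply neg_one_pow_eq_of_mod_two_eq
    obtain ⟨a, ha⟩ := hi
    rw [natAbs_mod_two, Nat.add_mod, natAbs_mod_two]
    omega
  · have hj : Odd j := by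
      obtain ⟨a, ha⟩ := hi
      exact ⟨n - a - 1, by omega⟩
    rw [Odd.neg_one_pow (hi.mul hj), mul_neg_one, ← pow_add, neg_eq_neg_one_mul, ← pow_succ']
    apply neg_one_pow_eq_of_mod_two_eq
    obtain ⟨a, ha⟩ := hi
    rw [Nat.add_mod, natAbs_mod_two, Nat.add_mod n, natAbs_mod_two]
    omega

/-- **`φ` is `(-1)^n`-symmetric: `φ(b, a) = (-1)^n φ(a, b)`** for `A` graded-commutative and `∫` vanishing outside
degree `2n` ("an invariant `(-)^n`-symmetric bilinear form"). [cite: LooijengaLunts1997, §1 (1.4) p. 5 L22–L25] -/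
theorem lefschetzForm_comm (hc : IsGradedCommutative K 𝒜) (n : ℕ) {intg : A →ₗ[K] K}
    (h0 : ∀ i : ℕ, i ≠ 2 * n → ∀ x ∈ 𝒜 i, intg x = 0) (x y : A) :
    lefschetzForm K 𝒜 n intg y x = ((-1 : K) ^ n) • lefschetzForm K 𝒜 n intg x y := by
  induction x using DirectSum.Decomposition.inductionOn 𝒜 with
  | zero => rw [map_zero, map_zero, LinearMap.zero_apply, smul_zero]
  | @homogeneous i x =>
    induction y using DirectSum.Decomposition.inductionOn 𝒜 with
    | zero => rw [map_zero, map_zero, LinearMap.zero_apply, smul_zero]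
    | @homogeneous j y =>
      by_cases hij : i + j = 2 * n
      · rw [lefschetzForm_apply_of_mem K 𝒜 n intg y.2, lefschetzForm_apply_of_mem K 𝒜 n intg x.2, hc.mul_comm' x.2 y.2,
          map_smul, smul_eq_mul, smul_eq_mul, smul_eq_mul, smul_eq_mul, ← mul_assoc, ← mul_assoc,
          neg_one_pow_lefschetzSign_symm hij]
      · rw [lefschetzForm_apply_eq_zero_of_ne n h0 (show j + i ≠ 2 * n by omega) y.2 x.2,
          lefschetzForm_apply_eq_zero_of_ne n h0 hij x.2 y.2, smul_zero]
    | add y y' hy hy' => rw [map_add, LinearMap.add_apply, map_add, smul_add, hy, hy']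
  | add x x' hx hx' => rw [map_add, map_add, LinearMap.add_apply, smul_add, hx, hx']

/-- **"`A` becomes a Frobenius algebra"**, the associativity of the pairing `(a, b) ↦ ∫(ab)`:
`∫((ab)c) = ∫(a(bc))`. [cite: LooijengaLunts1997, §1 (1.4) p. 5 L27–L29] -/
theorem mul_compr₂_apply_mul (intg : A →ₗ[K] K) (a b c : A) :
    (LinearMap.mul K A).compr₂ intg (a * b) c = (LinearMap.mul K A).compr₂ intg a (b * c) := by
  simp only [LinearMap.compr₂_apply, LinearMap.mul_apply', mul_assoc]

/-- **"If this form is nondegenerate …, then the form `(a, b) ↦ ∫(ab)` is also nondegenerate"** — and conversely: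
`φ(a, b) = ∫(ε(a) b)` with `ε` an involution. [cite: LooijengaLunts1997, §1 (1.4) p. 5 L25–L29] -/
theorem nondegenerate_lefschetzForm_iff (n : ℕ) (intg : A →ₗ[K] K) :
    (lefschetzForm K 𝒜 n intg).Nondegenerate ↔ ((LinearMap.mul K A).compr₂ intg).Nondegenerate := by
  have hφ : ∀ a b, lefschetzForm K 𝒜 n intg a b = (LinearMap.mul K A).compr₂ intg (lefschetzSign K 𝒜 n a) b :=
    fun a b ↦ rfl
  have hε := lefschetzSign_lefschetzSign K 𝒜 n
  constructor
  · rintro ⟨hl, hr⟩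
    refine ⟨fun a ha ↦ ?_, fun b hb ↦ ?_⟩
    · have h1 : lefschetzSign K 𝒜 n a = 0 := hl _ fun b ↦ by rw [hφ, hε]; exact ha b
      rw [← hε a, h1, map_zero]
    · exact hr _ fun a ↦ by rw [hφ]; exact hb _
  · rintro ⟨hl, hr⟩
    refine ⟨fun a ha ↦ ?_, fun b hb ↦ ?_⟩
    · have h1 : lefschetzSign K 𝒜 n a = 0 := hl _ fun b ↦ by rw [← hφ]; exact ha b
      rw [← hε a, h1, map_zero]
    · exact hr _ fun a ↦ by rw [← hε a, ← hφ]; exact hb _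

variable {n : ℕ}

/-- In a Lefschetz algebra every `L_a`, `a ∈ A_2`, preserves `φ` infinitesimally (`𝔞 ⊆ 𝔞𝔲𝔱(A[n], φ)`).
[cite: LooijengaLunts1997, §1 (1.4) p. 5 L22] [cite: LooijengaLunts1997, §1 (1.3) p. 7 L1–L6] -/
theorem IsLefschetzAlgebra.isSkewAdjoint_of_mem (L : IsLefschetzAlgebra K 𝒜 n) (intg : A →ₗ[K] K)
    {u : Module.End K A} (hu : u ∈ mulLeftDegTwo K 𝒜) : (lefschetzForm K 𝒜 n intg).IsSkewAdjoint u := by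
  obtain ⟨a, ha, rfl⟩ := (mem_mulLeftDegTwo_iff K 𝒜).1 hu
  exact isSkewAdjoint_lefschetzForm_mul L.isGradedCommutative n intg ha

end Form

/-! ### §5 (rider A1-122) Depth is positive; `φ` is non-degenerate when `A[n]` is irreducible -/

section Irreducible

variable {K : Type*} [Field K] {A : Type*} [Ring A] [Algebra K A] {𝒜 : ℕ → Submodule K A} [GradedAlgebra 𝒜] {n : ℕ}

/-- **A Lefschetz algebra has depth `n ≥ 1`** in this rendering: for `n = 0` the algebra is `A = A_0` and
`h = shiftedDegree K 𝒜 0 = 0`, which `IsLefschetzModule` (A1-88: `h ≠ 0`) excludes.  (The paper does not discuss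
depth `0`.) [cite: LooijengaLunts1997, §1 (1.4) p. 5 L17–L20] [cite: LooijengaLunts1997, §1 (1.1) p. 4 L2–L5] -/
theorem IsLefschetzAlgebra.depth_pos (L : IsLefschetzAlgebra K 𝒜 n) : 0 < n := by
  by_contra h0
  obtain rfl : n = 0 := by omega
  refine L.isLefschetzModule.h_ne_zero (LinearMap.ext fun x ↦ ?_)
  -- every `x` lies in `A_0`
  have hx : x ∈ 𝒜 0 := by
    have h1 : x ∈ ⨆ i, 𝒜 i := by
      rw [(DirectSum.Decomposition.isInternal 𝒜).submodule_iSup_eq_top]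
      exact Submodule.mem_top
    have h2 : ⨆ i, 𝒜 i ≤ 𝒜 0 := iSup_le fun i ↦ by
      rcases Nat.eq_zero_or_pos i with rfl | hi
      · exact le_rfl
      · rw [L.eq_bot_of_lt i (by omega)]
        exact bot_le
    exact h2 h1
  rw [shiftedDegree_apply_of_mem K 𝒜 0 hx, Nat.cast_zero, sub_self, Int.cast_zero, zero_smul, LinearMap.zero_apply]

/-- `φ ≠ 0` as soon as `∫` does not vanish identically on `A_{2n}`: `φ(1, x) = ±∫(x)`.
[cite: LooijengaLunts1997, §1 (1.4) p. 5 L21–L25] -/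
theorem lefschetzForm_ne_zero (n : ℕ) {intg : A →ₗ[K] K} (h1 : ∃ x ∈ 𝒜 (2 * n), intg x ≠ 0) :
    lefschetzForm K 𝒜 n intg ≠ 0 := by
  obtain ⟨x, -, hx0⟩ := h1
  intro hφ
  have h := LinearMap.congr_fun₂ hφ 1 x
  rw [lefschetzForm_apply_of_mem K 𝒜 n intg (SetLike.one_mem_graded 𝒜) x, one_mul, LinearMap.zero_apply,
    LinearMap.zero_apply, smul_eq_zero] at h
  rcases h with h | h
  · exact pow_ne_zero _ (neg_ne_zero.2 one_ne_zero) h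
  · exact hx0 h

variable [CharZero K] [FiniteDimensional K A]

/-- **(1.4), the parenthetical: "If this form is nondegenerate (which is for instance the case when `A[n]` is
irreducible as a Lefschetz module) …"** — for a Lefschetz algebra `A` of depth `n` whose `A[n]` is irreducible over
`𝔤(A_2, A[n])`, and `∫` vanishing off degree `2n` but not identically on `A_{2n}`, the form `φ(a, b) = (-1)^q ∫(ab)`
is non-degenerate: it is a non-zero invariant form on an irreducible Lefschetz module (A1-120
`IsLefschetzModule.nondegenerate_of_isIrreducible`; any field of characteristic `0`).
[cite: LooijengaLunts1997, §1 (1.4) p. 5 L25–L27] -/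
theorem IsLefschetzAlgebra.nondegenerate_lefschetzForm_of_isIrreducible (L : IsLefschetzAlgebra K 𝒜 n)
    {intg : A →ₗ[K] K} (h0 : ∀ i : ℕ, i ≠ 2 * n → ∀ x ∈ 𝒜 i, intg x = 0) (h1 : ∃ x ∈ 𝒜 (2 * n), intg x ≠ 0)
    [LieModule.IsIrreducible K (lefschetzLieAlgebra K (shiftedDegree K 𝒜 n) (mulLeftDegTwo K 𝒜)) A] :
    (lefschetzForm K 𝒜 n intg).Nondegenerate := by
  obtain ⟨x, -, hx0⟩ := id h1
  haveI : Nontrivial A := ⟨⟨x, 0, fun h ↦ hx0 (by rw [h, map_zero])⟩⟩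
  exact L.isLefschetzModule.nondegenerate_of_isIrreducible (lefschetzForm_ne_zero n h1)
    (isSkewAdjoint_lefschetzForm_shiftedDegree n h0) fun u hu ↦ L.isSkewAdjoint_of_mem intg hu

/-- **… "then the form `(a, b) ↦ ∫(ab)` is also nondegenerate and so `A` becomes a Frobenius algebra (in the graded
sense)"** — for `A[n]` irreducible. [cite: LooijengaLunts1997, §1 (1.4) p. 5 L25–L29] -/
theorem IsLefschetzAlgebra.nondegenerate_mul_compr₂_of_isIrreducible (L : IsLefschetzAlgebra K 𝒜 n)
    {intg : A →ₗ[K] K} (h0 : ∀ i : ℕ, i ≠ 2 * n → ∀ x ∈ 𝒜 i, intg x = 0) (h1 : ∃ x ∈ 𝒜 (2 * n), intg x ≠ 0)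
    [LieModule.IsIrreducible K (lefschetzLieAlgebra K (shiftedDegree K 𝒜 n) (mulLeftDegTwo K 𝒜)) A] :
    ((LinearMap.mul K A).compr₂ intg).Nondegenerate :=
  (nondegenerate_lefschetzForm_iff n intg).1 (L.nondegenerate_lefschetzForm_of_isIrreducible h0 h1)

end Irreducible


end Literature.Algebra.Lie
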